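/-
Copyright (c) 2026. All rights reserved.
Released under Apache 2.0 license as described in the file LICENSE.
Authors: abc-iut cell, wave-3 discharge seat abc-iut-L6-d2 (gen 2) (proof-only: RIGIDITY of `log_k̄` —
a `GaloisPadicLog` over a base of `ℚ_p ⊆ k ⊆ ℚ̄_p` that is the logarithmic series near `1` IS the real one).
-/
import Literature.AnabelianGeometry.AbsoluteAnabelian.GaloisPadicLogTower
import Literature.AnabelianGeometry.AbsoluteAnabelian.GaloisPadicLogPerfection
import HarnessLib

/-!
# Rigidity of `log_k̄` ([AbsTopIII] Def 3.1 (i)): the axioms plus the analytic germ at `1` determine it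

S. Mochizuki, *Topics in absolute anabelian geometry III* [MochizukiAbsTopIII2015], Def 3.1 (i), p. 66
l. 21–27: "Note that the [`p`-adic, if `k` is of residue characteristic `p`] logarithm determines a
`Π_k`-equivariant isomorphism `log_k̄ : k~ := (𝒪_k̄^×)^pf ⥲ k̄` [where “pf” denotes the perfection …] of
the topological group `k~` onto the additive topological group `k̄`".
abc-iut-L4-t2 typed `log_k̄` as the hypothesis structure `GaloisPadicLog k K` and recorded the CAVEAT
(`MLFGaloisModel.lean`): "these fields do NOT pin `log` down — for any `c ∈ k^×`, `c • log` satisfies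
them too — so everything built from a `GaloisPadicLog` (e.g. the pre-log-shell) is canonical only up to
`k^×`-scaling until the structure is instantiated from abc-iut-S1's analytic logarithm."  The real
instances now exist (`GaloisPadicLog.ofPadicAlgCl`, abc-iut-L3-t11; `ofPadicTower` / `ofPadicSubfield` /
`MLFClosure.galoisPadicLog`, this seat).  THIS PROOF-ONLY FILE retires the caveat in the other
direction: over any base `k` of the tower `ℚ_p ⊆ k ⊆ ℚ̄_p` (with `𝒪_k̄^×` over `k` = the unit sphere),

* `GaloisPadicLog.log_eq_padicLogAlgCl_of_eqOn_ball` — a `GaloisPadicLog k ℚ̄_p` whose `log` AGREES WITH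
  THE `p`-ADIC LOGARITHM ON SOME BALL `‖1 − u‖ ≤ ρ` (`ρ > 0`; i.e. is the logarithmic series near `1` —
  the defining normalisation of "the `p`-adic logarithm") coincides with the tree's Iwasawa logarithm
  `padicLogAlgCl` on ALL of `𝒪_k̄^×`: every unit has a power `u^{k p^N}` in the ball
  (`IwasawaLog.exists_norm_one_sub_pow_lt`, abc-iut-S1's `exists_norm_one_sub_pow_le`), and both maps
  are homomorphisms on `𝒪_k̄^×` into the characteristic-`0` group `(ℚ̄_p, +)`;
* `GaloisPadicLog.log_eq_ofPadicTowerUnits_log_of_eqOn_ball` — hence it has the same `log` as the real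
  instance, and `GaloisPadicLog.preLogShell_eq_of_eqOn_ball` — the same pre-log-shell (Def 3.1 (iv)):
  no `k^×`-scaling ambiguity survives the analytic normalisation.

Classical; no definitions; nothing here bears on [IUTchIII] Cor. 3.12; typed ≠ discharged.
-/

set_option autoImplicit false

noncomputable section

namespace Literature.AnabelianGeometry.AbsoluteAnabelian

open scoped ValuativeRel
open Literature.NumberTheory.Transcendental Literature.IUT.LogVolume

section Rigidity

variable (p : ℕ) [hp : Fact p.Prime]
variable {k : Type} [Field k] [ValuativeRel k] [Algebra ℚ_[p] k] [Algebra k (PadicAlgCl p)]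
  [IsScalarTower ℚ_[p] k (PadicAlgCl p)]

omit [Algebra ℚ_[p] k] [IsScalarTower ℚ_[p] k (PadicAlgCl p)] in
/-- **Rigidity of `log_k̄`**: over a base `k` of `ℚ_p ⊆ k ⊆ ℚ̄_p` with `𝒪_k̄^× = {‖x‖ = 1}`, a
`GaloisPadicLog k ℚ̄_p` that agrees with the `p`-adic logarithm `padicLogAlgCl` on some ball
`‖1 − u‖ ≤ ρ` (`ρ > 0`) agrees with it on the whole of `𝒪_k̄^×`.
[cite: MochizukiAbsTopIII2015, Definition 3.1 (i) p.66] -/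
theorem GaloisPadicLog.log_eq_padicLogAlgCl_of_eqOn_ball
    (hU : unitSubmonoid k (PadicAlgCl p) = unitSubmonoid ℚ_[p] (PadicAlgCl p))
    (L : GaloisPadicLog k (PadicAlgCl p)) {ρ : ℝ} (hρ : 0 < ρ)
    (hgerm : ∀ u : PadicAlgCl p, ‖1 - u‖ ≤ ρ → L.log u = padicLogAlgCl p u)
    {x : PadicAlgCl p} (hx : x ∈ unitSubmonoid k (PadicAlgCl p)) :
    L.log x = padicLogAlgCl p x := by
  have hI := padicLogAlgCl_isIwasawaLog_holds p
  have hxQ : x ∈ unitSubmonoid ℚ_[p] (PadicAlgCl p) := by rw [← hU]; exact hx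
  have hx1 : ‖x‖ = 1 := (PadicAlgCl.mem_unitSubmonoid_iff x).mp hxQ
  have hx0 : x ≠ 0 := PadicAlgCl.ne_zero_of_mem_unitSubmonoid hxQ
  -- a principal-unit power `x^k`, then a `p`-power of it inside the ball
  obtain ⟨k', hk', hxk⟩ := IwasawaLog.exists_norm_one_sub_pow_lt hx1
  haveI : IsUltrametricDist (PadicAlgCl p) := IsUltrametricDist.of_normedAlgebra ℚ_[p]
  obtain ⟨N, hN⟩ := exists_norm_one_sub_pow_le p (PadicAlgCl p) hxk hρ
  set M : ℕ := k' * p ^ N with hM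
  have hMpos : 0 < M := Nat.mul_pos hk' (pow_pos hp.out.pos N)
  have hxM : x ^ M = (x ^ k') ^ p ^ N := by rw [hM, pow_mul]
  -- both logarithms of `x^M` agree
  have hagree : L.log (x ^ M) = padicLogAlgCl p (x ^ M) := hgerm _ (by rw [hxM]; exact hN)
  rw [L.log_pow hx M, hI.log_pow hx0 M, nsmul_eq_mul] at hagree
  have hM0 : (M : PadicAlgCl p) ≠ 0 := by
    haveI : CharZero (PadicAlgCl p) :=
      charZero_of_injective_algebraMap (algebraMap ℚ_[p] (PadicAlgCl p)).injective
    exact_mod_cast hMpos.ne'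
  exact mul_left_cancel₀ hM0 hagree

/-- Hence such a `GaloisPadicLog` has the SAME logarithm as the real instance
`GaloisPadicLog.ofPadicTowerUnits` on `𝒪_k̄^×` (no `k^×`-scaling ambiguity survives the analytic
normalisation). [cite: MochizukiAbsTopIII2015, Definition 3.1 (i) p.66] -/
theorem GaloisPadicLog.log_eq_ofPadicTowerUnits_log_of_eqOn_ball
    (hU : unitSubmonoid k (PadicAlgCl p) = unitSubmonoid ℚ_[p] (PadicAlgCl p))
    (L : GaloisPadicLog k (PadicAlgCl p)) {ρ : ℝ} (hρ : 0 < ρ)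
    (hgerm : ∀ u : PadicAlgCl p, ‖1 - u‖ ≤ ρ → L.log u = padicLogAlgCl p u)
    {x : PadicAlgCl p} (hx : x ∈ unitSubmonoid k (PadicAlgCl p)) :
    L.log x = (GaloisPadicLog.ofPadicTowerUnits p hU).log x := by
  rw [GaloisPadicLog.ofPadicTowerUnits_log]
  exact L.log_eq_padicLogAlgCl_of_eqOn_ball p hU hρ hgerm hx

/-- … and the SAME pre-log-shell ([AbsTopIII] Def 3.1 (iv) p. 69): the compactum `log_k̄((𝒪_k̄^×)^{G_k})`
of an analytically normalised `GaloisPadicLog` is that of the real logarithm.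
[cite: MochizukiAbsTopIII2015, Definition 3.1 (iv) p.69] -/
theorem GaloisPadicLog.preLogShell_eq_of_eqOn_ball
    (hU : unitSubmonoid k (PadicAlgCl p) = unitSubmonoid ℚ_[p] (PadicAlgCl p))
    (L : GaloisPadicLog k (PadicAlgCl p)) {ρ : ℝ} (hρ : 0 < ρ)
    (hgerm : ∀ u : PadicAlgCl p, ‖1 - u‖ ≤ ρ → L.log u = padicLogAlgCl p u) :
    L.preLogShell = (GaloisPadicLog.ofPadicTowerUnits p hU).preLogShell := by
  unfold GaloisPadicLog.preLogShell
  congr 1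
  refine Set.image_congr fun x hx => ?_
  exact L.log_eq_ofPadicTowerUnits_log_of_eqOn_ball p hU hρ hgerm hx.1

/-- The same rigidity for a base `k` whose valuation ring is the pull-back of the unit ball (the
hypothesis `hO` of `GaloisPadicLog.ofPadicTower`), e.g. every intermediate field `E` of `ℚ̄_p/ℚ_p` with
`PadicAlgCl.subfieldValuativeRel`. [cite: MochizukiAbsTopIII2015, Definition 3.1 (i) p.66] -/
theorem GaloisPadicLog.log_eq_padicLogAlgCl_of_eqOn_ball'
    (hO : ∀ c : k, c ∈ 𝒪[k] ↔ ‖algebraMap k (PadicAlgCl p) c‖ ≤ 1)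
    (L : GaloisPadicLog k (PadicAlgCl p)) {ρ : ℝ} (hρ : 0 < ρ)
    (hgerm : ∀ u : PadicAlgCl p, ‖1 - u‖ ≤ ρ → L.log u = padicLogAlgCl p u)
    {x : PadicAlgCl p} (hx : x ∈ unitSubmonoid k (PadicAlgCl p)) :
    L.log x = padicLogAlgCl p x :=
  L.log_eq_padicLogAlgCl_of_eqOn_ball p (unitSubmonoid_tower_eq p hO) hρ hgerm hx

end Rigidity

end Literature.AnabelianGeometry.AbsoluteAnabelian

end
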